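import Summits.CriticalPhenomena.Ising3DConformalLimit.Theorems.InverseSquareTelemetryPositiveSolutionAsymptoticsLocalComparison
import Summits.CriticalPhenomena.Ising3DConformalLimit.Theorems.InverseSquareTelemetryPositiveSolutionAsymptoticsAssemblyTools
import HarnessLib

/-!
# Crux `PositiveSolutionAsymptotics` (stmt-CriticalPhenomena-4496), stub H4
# `stub_harnackOfProfiles`: the Schrödinger–Harnack inequality on lattice balls of `ℤ³`

THEOREM-ONLY file (no definitions, no named facts), `--supports stmt-CriticalPhenomena-4496`.
`stub_harnackOfProfiles` is stub H4 of the registered skeleton of crux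
`…Theses.InverseSquareTelemetry.PositiveSolutionAsymptotics`: a scale-invariant Harnack inequality
for nonnegative solutions of `Δw = Vw` on lattice balls `B = {z : |z - x₀| ≤ R} ⊆ ℤ³` with
`R² |V| ≤ c₀`, from the sub/super-profiles of stubs H3∓ and Green's second identity (stub H1). With
the weight `h₀ = 8R² - |· - x₀|²` (`Δh₀ = -6 ≤ V h₀`) the `h`-transform maximum principle
`subsolution_nonpos_of_hTransform_of_finite` and Dirichlet solvability
`exists_latticeLaplacianZd_sub_mul_eq_eq_off_of_hTransform` apply on `B`; the `(Δ-V)`-Green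
functions `Ψ_x, Ψ_y` of `B` with poles in the core satisfy `Ψ_x ≤ Γ₊(· - x)` and
`2Ψ_y ≥ Γ₋(· - y) - 2a₀/R` on `B`, hence `Ψ_x ≤ 18a₀/R`, `Ψ_y ≥ (2/5)a₀/R` next to the sphere
`|z - x₀| = R/4`, so `Ψ_x ≤ 45 Ψ_y` on the annulus `R/4 < |z - x₀| ≤ R` (maximum principle there),
and Green's identity `w(p) = Σ_{z ∈ B} Ψ_p(z) Σ_{ξ ∼ z, ξ ∉ B} w(ξ)` gives `w(x) ≤ 45 w(y)`.
Everything is [folklore] (discrete potential theory; Lawler, *Intersections of Random Walks*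
(1991), §1.4).
-/

noncomputable section

namespace Summit.CriticalPhenomena.Ising3DConformalLimit.Theorems.PositiveSolutionAsymptotics

open Literature.Probability.LatticeModels Finset

/-- Triangle inequalities in coordinates: `|z - p| ≤ |z - x₀| + |p - x₀|` and
`|z - x₀| ≤ |z - p| + |p - x₀|` in `ℝ³`. [folklore] -/
theorem ballHarnack_norm_sub_bounds (z p x₀ : Site 3) :
    Real.sqrt (∑ i, (((z - p : Site 3) i : ℤ) : ℝ) ^ 2) ≤
        Real.sqrt (∑ i, (((z i : ℤ) : ℝ) - ((x₀ i : ℤ) : ℝ)) ^ 2) +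
          Real.sqrt (∑ i, (((p i : ℤ) : ℝ) - ((x₀ i : ℤ) : ℝ)) ^ 2) ∧
      Real.sqrt (∑ i, (((z i : ℤ) : ℝ) - ((x₀ i : ℤ) : ℝ)) ^ 2) ≤
        Real.sqrt (∑ i, (((z - p : Site 3) i : ℤ) : ℝ) ^ 2) +
          Real.sqrt (∑ i, (((p i : ℤ) : ℝ) - ((x₀ i : ℤ) : ℝ)) ^ 2) := by
  have h1 := Assembly.sqrt_sumSq_le_add_sub' (fun i => ((z i : ℤ) : ℝ) - ((x₀ i : ℤ) : ℝ))
    (fun i => ((z i : ℤ) : ℝ) - ((p i : ℤ) : ℝ))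
  have h2 := Literature.Geometry.Lorentzian.sqrt_sum_sq_le_add
    (fun i => ((z i : ℤ) : ℝ) - ((x₀ i : ℤ) : ℝ)) (fun i => ((z i : ℤ) : ℝ) - ((p i : ℤ) : ℝ))
  have e : ∀ i, ((z i : ℤ) : ℝ) - ((x₀ i : ℤ) : ℝ) - (((z i : ℤ) : ℝ) - ((p i : ℤ) : ℝ)) =
      ((p i : ℤ) : ℝ) - ((x₀ i : ℤ) : ℝ) := fun i => by ring
  simp only [e] at h1 h2
  simp only [Pi.sub_apply, Int.cast_sub]
  exact ⟨h1, h2⟩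

/-- The lattice ball `{z : |z - x₀| ≤ R}` is finite. [folklore] -/
theorem ballHarnack_ball_finite (R : ℝ) (x₀ : Site 3) :
    {z : Site 3 | Real.sqrt (∑ i, (((z i : ℤ) : ℝ) - ((x₀ i : ℤ) : ℝ)) ^ 2) ≤ R}.Finite := by
  refine (EtaBoundsFromTelemetry.finite_sumSq_le
    ((Real.sqrt (∑ i, ((x₀ i : ℤ) : ℝ) ^ 2) + R) ^ 2)).subset fun z hz => ?_
  have h1 := Literature.Geometry.Lorentzian.sqrt_sum_sq_le_add (fun i => ((z i : ℤ) : ℝ))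
    (fun i => ((x₀ i : ℤ) : ℝ))
  have hz' : Real.sqrt (∑ i, (((z i : ℤ) : ℝ) - ((x₀ i : ℤ) : ℝ)) ^ 2) ≤ R := hz
  exact (Real.sqrt_le_iff.1 (h1.trans (by linarith))).2

/-- The weight `h₀(z) = 8R² - |z - x₀|²` has Laplacian `-6`. [folklore] -/
theorem ballHarnack_laplacian_weight (R : ℝ) (x₀ z : Site 3) :
    latticeLaplacianZd
        (fun t : Site 3 => 8 * R ^ 2 - ∑ i, (((t i : ℤ) : ℝ) - ((x₀ i : ℤ) : ℝ)) ^ 2) z = -6 := by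
  rw [latticeLaplacianZd_def, Fin.sum_univ_three]
  simp only [Fin.sum_univ_three, Pi.add_apply, Pi.sub_apply, Pi.single_apply,
    Int.cast_add, Int.cast_sub, Int.cast_ite, Int.cast_one, Int.cast_zero]
  norm_num [Fin.ext_iff]
  ring

/-- The Laplacian of a shifted translate `t ↦ Γ(t - p) - c`. [folklore] -/
theorem ballHarnack_laplacian_translate (Γ : Site 3 → ℝ) (p z : Site 3) (c : ℝ) :
    latticeLaplacianZd (fun t => Γ (t - p) - c) z = latticeLaplacianZd Γ (z - p) := by
  have e : (fun t => Γ (t - p) - c) = fun t => (fun s => Γ (s + -p)) t + -c := by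
    funext t; simp only [sub_eq_add_neg]
  rw [e, latticeLaplacianZd_add_const, latticeLaplacianZd_comp_add, sub_eq_add_neg]

/-- **H4 (Schrödinger–Harnack on lattice balls from the comparison profiles).** If for some `a₀ > 0`
sub- and super-profiles as in H3∓ exist at every large scale, and Green's second identity holds on
finite subsets of `ℤ³`, then there are `c₀ > 0`, `C ≥ 1`, `R₀` such that for `R ≥ R₀`, every `x₀`,
every potential with `|V| ≤ c₀/R²` on `B = B(x₀, R)` and every `w ≥ 0` on `B ∪ ∂B` solving `Δw = Vw`
on `B`, `w x ≤ C w y` for all `x, y ∈ B(x₀, R/16)`; here `c₀ = min (min c₁⁻ c₁⁺) (1/2)`, `C = 45`,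
`R₀ = max (max R₀⁻ R₀⁺) 64` (see the module docstring for the proof). [folklore] -/
theorem stub_harnackOfProfiles :
    ∀ a₀ : ℝ, 0 < a₀ →
      (∃ (R₀ c₁ : ℝ), 0 < c₁ ∧ ∀ R : ℝ, R₀ ≤ R → ∃ Γ : Literature.Probability.LatticeModels.Site 3 → ℝ,
        (∀ (V : Literature.Probability.LatticeModels.Site 3 → ℝ) (τ : ℝ), 0 ≤ τ → τ ≤ 2 * a₀ / R →
          (∀ z : Literature.Probability.LatticeModels.Site 3, Real.sqrt (∑ i, ((z i : ℤ) : ℝ) ^ 2) ≤ 3 * R → |V z| ≤ c₁ / R ^ 2) →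
          (∀ z : Literature.Probability.LatticeModels.Site 3, z ≠ 0 → Real.sqrt (∑ i, ((z i : ℤ) : ℝ) ^ 2) ≤ 3 * R →
              V z * (Γ z - τ) ≤ Literature.Probability.LatticeModels.latticeLaplacianZd Γ z) ∧
            V 0 * (Γ 0 - τ) - 2 ≤ Literature.Probability.LatticeModels.latticeLaplacianZd Γ 0) ∧
        (∀ z : Literature.Probability.LatticeModels.Site 3, R / 8 ≤ Real.sqrt (∑ i, ((z i : ℤ) : ℝ) ^ 2) → Real.sqrt (∑ i, ((z i : ℤ) : ℝ) ^ 2) ≤ 3 * R →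
          7 / 8 * (a₀ / Real.sqrt (∑ i, ((z i : ℤ) : ℝ) ^ 2)) ≤ Γ z ∧
            Γ z ≤ 9 / 8 * (a₀ / Real.sqrt (∑ i, ((z i : ℤ) : ℝ) ^ 2)) * (1 + Real.sqrt (∑ i, ((z i : ℤ) : ℝ) ^ 2) ^ 2 / (4 * R ^ 2)))) →
      (∃ (R₀ c₁ : ℝ), 0 < c₁ ∧ ∀ R : ℝ, R₀ ≤ R → ∃ Γ : Literature.Probability.LatticeModels.Site 3 → ℝ,
        (∀ V : Literature.Probability.LatticeModels.Site 3 → ℝ,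
          (∀ z : Literature.Probability.LatticeModels.Site 3, Real.sqrt (∑ i, ((z i : ℤ) : ℝ) ^ 2) ≤ 3 * R → |V z| ≤ c₁ / R ^ 2) →
          (∀ z : Literature.Probability.LatticeModels.Site 3, z ≠ 0 → Real.sqrt (∑ i, ((z i : ℤ) : ℝ) ^ 2) ≤ 3 * R →
              Literature.Probability.LatticeModels.latticeLaplacianZd Γ z ≤ V z * Γ z) ∧
            Literature.Probability.LatticeModels.latticeLaplacianZd Γ 0 ≤ V 0 * Γ 0 - 1) ∧
        (∀ z : Literature.Probability.LatticeModels.Site 3, Real.sqrt (∑ i, ((z i : ℤ) : ℝ) ^ 2) ≤ 2 * R → 0 ≤ Γ z) ∧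
        (∀ z : Literature.Probability.LatticeModels.Site 3, R / 8 ≤ Real.sqrt (∑ i, ((z i : ℤ) : ℝ) ^ 2) → Real.sqrt (∑ i, ((z i : ℤ) : ℝ) ^ 2) ≤ 3 * R →
          Γ z ≤ 9 / 4 * (a₀ / Real.sqrt (∑ i, ((z i : ℤ) : ℝ) ^ 2)))) →
      (∀ (D : Finset (Literature.Probability.LatticeModels.Site 3)) (f g : Literature.Probability.LatticeModels.Site 3 → ℝ),
        ∑ x ∈ D, (f x * Literature.Probability.LatticeModels.latticeLaplacianZd g x - g x * Literature.Probability.LatticeModels.latticeLaplacianZd f x) =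
        ∑ x ∈ D, ∑ i : Fin 3, ((if x + Pi.single i 1 ∈ D then (0 : ℝ) else (f x * g (x + Pi.single i 1) - g x * f (x + Pi.single i 1))) + (if x - Pi.single i 1 ∈ D then (0 : ℝ) else (f x * g (x - Pi.single i 1) - g x * f (x - Pi.single i 1))))) →
      ∃ c₀ : ℝ, 0 < c₀ ∧ ∃ C : ℝ, 1 ≤ C ∧ ∃ R₀ : ℝ, ∀ R : ℝ, R₀ ≤ R →
        ∀ (x₀ : Literature.Probability.LatticeModels.Site 3) (V w : Literature.Probability.LatticeModels.Site 3 → ℝ),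
          (∀ z : Literature.Probability.LatticeModels.Site 3, Real.sqrt (∑ i, (((z i : ℤ) : ℝ) - ((x₀ i : ℤ) : ℝ)) ^ 2) ≤ R → |V z| ≤ c₀ / R ^ 2) →
          (∀ z ∈ {z : Literature.Probability.LatticeModels.Site 3 | Real.sqrt (∑ i, (((z i : ℤ) : ℝ) - ((x₀ i : ℤ) : ℝ)) ^ 2) ≤ R} ∪ Literature.Probability.LatticeModels.zdOuterBoundary {z : Literature.Probability.LatticeModels.Site 3 | Real.sqrt (∑ i, (((z i : ℤ) : ℝ) - ((x₀ i : ℤ) : ℝ)) ^ 2) ≤ R}, 0 ≤ w z) →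
          (∀ z : Literature.Probability.LatticeModels.Site 3, Real.sqrt (∑ i, (((z i : ℤ) : ℝ) - ((x₀ i : ℤ) : ℝ)) ^ 2) ≤ R →
              Literature.Probability.LatticeModels.latticeLaplacianZd w z = V z * w z) →
          ∀ x y : Literature.Probability.LatticeModels.Site 3,
            Real.sqrt (∑ i, (((x i : ℤ) : ℝ) - ((x₀ i : ℤ) : ℝ)) ^ 2) ≤ R / 16 →
            Real.sqrt (∑ i, (((y i : ℤ) : ℝ) - ((x₀ i : ℤ) : ℝ)) ^ 2) ≤ R / 16 → w x ≤ C * w y := by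
  intro a₀ ha₀ hsub hsup hGreen
  obtain ⟨Rm, cm, hcm, hΓm⟩ := hsub
  obtain ⟨Rp, cp, hcp, hΓp⟩ := hsup
  refine ⟨min (min cm cp) (1 / 2), by positivity, 45, by norm_num, max (max Rm Rp) 64, ?_⟩
  intro R hR x₀ V w hV hw0 hw x y hx hy
  have hR64 : 64 ≤ R := le_trans (le_max_right _ _) hR
  have hR0 : 0 < R := by linarith
  obtain ⟨Γm, hΓm1, hΓm2⟩ := hΓm R (le_trans (le_trans (le_max_left _ _) (le_max_left _ _)) hR)
  obtain ⟨Γp, hΓp1, hΓp2, hΓp3⟩ :=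
    hΓp R (le_trans (le_trans (le_max_right _ _) (le_max_left _ _)) hR)
  have hc : min (min cm cp) (1 / 2) ≤ cm ∧ min (min cm cp) (1 / 2) ≤ cp ∧
      min (min cm cp) (1 / 2) ≤ 1 / 2 :=
    ⟨(min_le_left _ _).trans (min_le_left _ _), (min_le_left _ _).trans (min_le_right _ _),
      min_le_right _ _⟩
  -- the distance to the centre `nd z = |z - x₀|`, the ball `B` and its closure
  obtain ⟨nd, hnd⟩ : ∃ nd : Site 3 → ℝ,
      ∀ z : Site 3, Real.sqrt (∑ i, (((z i : ℤ) : ℝ) - ((x₀ i : ℤ) : ℝ)) ^ 2) = nd z :=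
    ⟨_, fun _ => rfl⟩
  have hstep : ∀ (z : Site 3) (k : Fin 3), nd (z + Pi.single k 1) ≤ nd z + 1 ∧
      nd (z - Pi.single k 1) ≤ nd z + 1 := fun z k => by
    simpa only [hnd] using Assembly.sqrt_sumSq_step_le z x₀ k
  have htri : ∀ z p : Site 3, Real.sqrt (∑ i, (((z - p : Site 3) i : ℤ) : ℝ) ^ 2) ≤ nd z + nd p ∧
      nd z ≤ Real.sqrt (∑ i, (((z - p : Site 3) i : ℤ) : ℝ) ^ 2) + nd p := fun z p => by
    simpa only [hnd] using ballHarnack_norm_sub_bounds z p x₀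
  have hfin : {z : Site 3 | nd z ≤ R}.Finite := by
    simpa only [hnd] using ballHarnack_ball_finite R x₀
  have hsq : ∀ t, nd t ^ 2 = ∑ i, (((t i : ℤ) : ℝ) - ((x₀ i : ℤ) : ℝ)) ^ 2 := fun t => by
    rw [← hnd, Real.sq_sqrt (by positivity)]
  simp only [hnd] at hV hw0 hw hx hy
  set B : Set (Site 3) := {z : Site 3 | nd z ≤ R}
  have hcl : ∀ z ∈ B ∪ zdOuterBoundary B, nd z ≤ R + 1 := by
    rintro z (hz | ⟨-, v, hv, k, rfl | rfl⟩)
    · exact (show nd z ≤ R from hz).trans (by linarith)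
    · exact (hstep v k).1.trans (by linarith [show nd v ≤ R from hv])
    · exact (hstep v k).2.trans (by linarith [show nd v ≤ R from hv])
  -- the weight `h₀ = 8R² - nd²` of the maximum principles
  have hpos : ∀ z ∈ B ∪ zdOuterBoundary B, 0 < 8 * R ^ 2 - nd z ^ 2 := fun z hz => by
    have h0 : 0 ≤ nd z := by rw [← hnd]; exact Real.sqrt_nonneg _
    nlinarith [hcl z hz]
  have hsuper : ∀ z ∈ B, latticeLaplacianZd (fun t => 8 * R ^ 2 - nd t ^ 2) z ≤
      V z * (8 * R ^ 2 - nd z ^ 2) := by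
    intro z hz
    have hΔ : latticeLaplacianZd (fun t => 8 * R ^ 2 - nd t ^ 2) z = -6 := by
      simp only [hsq]
      exact ballHarnack_laplacian_weight R x₀ z
    have hVlo : -(1 / (2 * R ^ 2)) ≤ V z := by
      have h1 := (abs_le.1 (hV z hz)).1
      have h2 : min (min cm cp) (1 / 2) / R ^ 2 ≤ 1 / (2 * R ^ 2) :=
        (div_le_div_of_nonneg_right hc.2.2 (sq_nonneg R)).trans_eq (by ring)
      linarith
    have h2 := mul_le_mul_of_nonneg_right hVlo (hpos z (Or.inl hz)).le
    have h3 : -(1 / (2 * R ^ 2)) * (8 * R ^ 2 - nd z ^ 2) = -4 + nd z ^ 2 / (2 * R ^ 2) := by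
      field_simp
      ring
    have h4 : 0 ≤ nd z ^ 2 / (2 * R ^ 2) := by positivity
    linarith
  -- the `(Δ - V)`-Green functions of `B` with poles `x` and `y`
  obtain ⟨Ψx, hΨx, hΨx0⟩ := exists_latticeLaplacianZd_sub_mul_eq_eq_off_of_hTransform (d := 3)
    (by norm_num) hfin (h := fun t => 8 * R ^ 2 - nd t ^ 2) hpos hsuper
    (fun z => if z = x then -1 else 0) fun _ => 0
  obtain ⟨Ψy, hΨy, hΨy0⟩ := exists_latticeLaplacianZd_sub_mul_eq_eq_off_of_hTransform (d := 3)
    (by norm_num) hfin (h := fun t => 8 * R ^ 2 - nd t ^ 2) hpos hsuper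
    (fun z => if z = y then -1 else 0) fun _ => 0
  -- the profiles for the translated, truncated potentials
  have hVt : ∀ p t : Site 3, |(if t + p ∈ B then V (t + p) else 0)| ≤
      min (min cm cp) (1 / 2) / R ^ 2 := by
    intro p t
    split_ifs with h
    · exact hV _ h
    · rw [abs_zero]
      positivity
  obtain ⟨hΓp1a, hΓp1b⟩ := hΓp1 (fun t => if t + x ∈ B then V (t + x) else 0)
    fun t _ => (hVt x t).trans (div_le_div_of_nonneg_right hc.2.1 (sq_nonneg R))
  obtain ⟨hΓm1a, hΓm1b⟩ := hΓm1 (fun t => if t + y ∈ B then V (t + y) else 0) (2 * a₀ / R)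
    (by positivity) le_rfl
    fun t _ => (hVt y t).trans (div_le_div_of_nonneg_right hc.1 (sq_nonneg R))
  -- Step 1: `Ψx ≤ Γ₊(· - x)` on `B`, hence `Ψx ≤ 18 a₀/R` away from `x`
  have hU : ∀ z ∈ B, R / 4 - 1 < nd z → Ψx z ≤ 18 * (a₀ / R) := by
    have hcmp := subsolution_nonpos_of_hTransform_of_finite (d := 3) (by norm_num) hfin
      (f := Ψx - fun t => Γp (t - x) - 0) (h := fun t => 8 * R ^ 2 - nd t ^ 2) hpos hsuper
      (fun z hz => ?_) (fun ξ hξ => ?_)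
    · intro z hz hfar
      have h1 := hcmp z hz
      rw [Pi.sub_apply, sub_zero] at h1
      have hlo : R / 8 ≤ Real.sqrt (∑ i, (((z - x : Site 3) i : ℤ) : ℝ) ^ 2) := by
        linarith [(htri z x).2]
      have h2 := hΓp3 (z - x) hlo (by linarith [(htri z x).1, hcl z (Or.inl hz)])
      have h3 : a₀ / Real.sqrt (∑ i, (((z - x : Site 3) i : ℤ) : ℝ) ^ 2) ≤ a₀ / (R / 8) :=
        div_le_div_of_nonneg_left ha₀.le (by positivity) hlo
      have h4 : a₀ / (R / 8) = 8 * (a₀ / R) := by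
        rw [div_div_eq_mul_div]
        ring
      linarith
    · rw [latticeLaplacianZd_sub, ballHarnack_laplacian_translate, Pi.sub_apply, sub_zero]
      have h1 := hΨx z hz
      by_cases hzp : z = x
      · subst hzp
        rw [if_pos rfl] at h1
        have h2 := hΓp1b
        simp only [zero_add, if_pos hz] at h2
        rw [sub_self]
        linarith
      · rw [if_neg hzp] at h1
        have h2 := hΓp1a (z - x) (sub_ne_zero.2 hzp)
          (by linarith [(htri z x).1, hcl z (Or.inl hz)])
        simp only [sub_add_cancel, if_pos hz] at h2
        linarith
    · rw [Pi.sub_apply, sub_zero, hΨx0 ξ hξ.1, zero_sub, neg_nonpos]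
      exact hΓp2 _ (by linarith [(htri ξ x).1, hcl ξ (Or.inr hξ)])
  -- Step 2: `Γ₋(· - y) - 2a₀/R ≤ 2Ψy` on `B`, hence `Ψy ≥ (2/5) a₀/R` near `|z - x₀| = R/4`
  have hL : ∀ z ∈ B, R / 4 - 1 < nd z → nd z ≤ R / 4 → 2 / 5 * (a₀ / R) ≤ Ψy z := by
    have hcmp := subsolution_nonpos_of_hTransform_of_finite (d := 3) (by norm_num) hfin
      (f := (fun t => Γm (t - y) - 2 * a₀ / R) - fun t => 2 * Ψy t)
      (h := fun t => 8 * R ^ 2 - nd t ^ 2) hpos hsuper (fun z hz => ?_) (fun ξ hξ => ?_)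
    · intro z hz hfar hnear
      have h1 := hcmp z hz
      rw [Pi.sub_apply] at h1
      have hlo : R / 8 ≤ Real.sqrt (∑ i, (((z - y : Site 3) i : ℤ) : ℝ) ^ 2) := by
        linarith [(htri z y).2]
      have hhi : Real.sqrt (∑ i, (((z - y : Site 3) i : ℤ) : ℝ) ^ 2) ≤ 5 * R / 16 := by
        linarith [(htri z y).1]
      have h2 := (hΓm2 (z - y) hlo (by linarith)).1
      have h3 : a₀ / (5 * R / 16) ≤ a₀ / Real.sqrt (∑ i, (((z - y : Site 3) i : ℤ) : ℝ) ^ 2) :=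
        div_le_div_of_nonneg_left ha₀.le ((by linarith : (0 : ℝ) < R / 8).trans_le hlo) hhi
      have h4 : a₀ / (5 * R / 16) = 16 / 5 * (a₀ / R) := by
        rw [div_div_eq_mul_div]
        ring
      have h5 : 2 * a₀ / R = 2 * (a₀ / R) := by ring
      rw [h5] at h1
      linarith
    · rw [latticeLaplacianZd_sub, ballHarnack_laplacian_translate, latticeLaplacianZd_const_mul,
        Pi.sub_apply]
      have h1 := hΨy z hz
      by_cases hzp : z = y
      · subst hzp
        rw [if_pos rfl] at h1
        have h2 := hΓm1b
        simp only [zero_add, if_pos hz] at h2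
        rw [sub_self]
        linarith
      · rw [if_neg hzp] at h1
        have h2 := hΓm1a (z - y) (sub_ne_zero.2 hzp)
          (by linarith [(htri z y).1, hcl z (Or.inl hz)])
        simp only [sub_add_cancel, if_pos hz] at h2
        linarith
    · -- on `∂B`: `|ξ - y| ∈ [15R/16, 69R/64]`, so `Γ₋(ξ - y) ≤ 2a₀/R`
      rw [Pi.sub_apply, hΨy0 ξ hξ.1, mul_zero, sub_zero, sub_nonpos]
      have hout : R < nd ξ := not_le.1 hξ.1
      have hlo : 15 * R / 16 ≤ Real.sqrt (∑ i, (((ξ - y : Site 3) i : ℤ) : ℝ) ^ 2) := by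
        linarith [(htri ξ y).2]
      have hhi : Real.sqrt (∑ i, (((ξ - y : Site 3) i : ℤ) : ℝ) ^ 2) ≤ 69 * R / 64 := by
        linarith [(htri ξ y).1, hcl ξ (Or.inr hξ)]
      refine ((hΓm2 (ξ - y) (by linarith) (by linarith)).2).trans ?_
      calc 9 / 8 * (a₀ / Real.sqrt (∑ i, (((ξ - y : Site 3) i : ℤ) : ℝ) ^ 2)) *
            (1 + Real.sqrt (∑ i, (((ξ - y : Site 3) i : ℤ) : ℝ) ^ 2) ^ 2 / (4 * R ^ 2))
          ≤ 9 / 8 * (a₀ / (15 * R / 16)) * (1 + (69 * R / 64) ^ 2 / (4 * R ^ 2)) := by gcongr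
        _ = (9 / 8 * (16 / 15) * (1 + (69 / 64) ^ 2 / 4)) * (a₀ / R) := by field_simp
        _ ≤ 2 * (a₀ / R) := mul_le_mul_of_nonneg_right (by norm_num) (by positivity)
        _ = 2 * a₀ / R := by ring
  -- Step 3: `Ψx ≤ 45 Ψy` on the annulus `A = {R/4 < |z - x₀| ≤ R}` (maximum principle on `A`)
  have hA : ∀ z ∈ B, R / 4 < nd z → Ψx z ≤ 45 * Ψy z := by
    set A : Set (Site 3) := {z : Site 3 | R / 4 < nd z ∧ nd z ≤ R}
    have hAB : A ⊆ B := fun z hz => hz.2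
    have hclA : ∀ z ∈ A ∪ zdOuterBoundary A, z ∈ B ∪ zdOuterBoundary B := by
      rintro z (hz | ⟨-, a, ha, i, rfl | rfl⟩)
      · exact Or.inl (hAB hz)
      · exact add_single_mem_union_zdOuterBoundary (hAB ha) i
      · exact sub_single_mem_union_zdOuterBoundary (hAB ha) i
    have hcmp := subsolution_nonpos_of_hTransform_of_finite (d := 3) (by norm_num)
      (hfin.subset hAB) (f := Ψx - fun t => 45 * Ψy t) (h := fun t => 8 * R ^ 2 - nd t ^ 2)
      (fun z hz => hpos z (hclA z hz)) (fun z hz => hsuper z (hAB hz)) (fun z hz => ?_)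
      (fun ξ hξ => ?_)
    · intro z hz hfar
      have h1 := hcmp z ⟨hfar, hz⟩
      rw [Pi.sub_apply] at h1
      linarith
    · -- `Ψx - 45 Ψy` is `(Δ - V)`-harmonic on `A` (the poles lie in the core)
      rw [latticeLaplacianZd_sub, latticeLaplacianZd_const_mul, Pi.sub_apply]
      have h1 := hΨx z (hAB hz)
      have h2 := hΨy z (hAB hz)
      rw [if_neg (by rintro rfl; linarith [hz.1])] at h1 h2
      linarith
    · rw [Pi.sub_apply, sub_nonpos]
      obtain ⟨hξA, a, ha, i, hξa⟩ := hξ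
      by_cases hξB : nd ξ ≤ R
      · have hle : nd ξ ≤ R / 4 := by
          by_contra hlt
          exact hξA ⟨not_le.1 hlt, hξB⟩
        have hgt : R / 4 - 1 < nd ξ := by
          rcases hξa with rfl | rfl
          · have hs := (hstep (a + Pi.single i 1) i).2
            rw [add_sub_cancel_right] at hs
            linarith [ha.1]
          · have hs := (hstep (a - Pi.single i 1) i).1
            rw [sub_add_cancel] at hs
            linarith [ha.1]
        linarith [hU ξ hξB hgt, hL ξ hξB hgt hle]
      · rw [hΨx0 ξ hξB, hΨy0 ξ hξB, mul_zero]
  -- Step 4: the boundary representation `w(p) = Σ_{z ∈ B} Ψ_p(z) F(z)` (Green's second identity)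
  obtain ⟨F, hF⟩ : ∃ F : Site 3 → ℝ, ∀ z, F z = ∑ i : Fin 3,
      ((if z + Pi.single i 1 ∈ hfin.toFinset then (0 : ℝ) else w (z + Pi.single i 1)) +
        (if z - Pi.single i 1 ∈ hfin.toFinset then (0 : ℝ) else w (z - Pi.single i 1))) :=
    ⟨_, fun _ => rfl⟩
  have hrep : ∀ (p : Site 3) (Ψ : Site 3 → ℝ), nd p ≤ R / 16 →
      (∀ z ∈ B, latticeLaplacianZd Ψ z - V z * Ψ z = if z = p then -1 else 0) →
      (∀ z ∉ B, Ψ z = 0) → w p = ∑ z ∈ hfin.toFinset, Ψ z * F z := by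
    intro p Ψ hp hΨ hΨ0
    have hpD : p ∈ hfin.toFinset := hfin.mem_toFinset.2 (show nd p ≤ R by linarith)
    have hΨ0' : ∀ u, u ∉ hfin.toFinset → Ψ u = 0 := fun u hu =>
      hΨ0 u fun h => hu (hfin.mem_toFinset.2 h)
    have hG := hGreen hfin.toFinset w Ψ
    have hl : ∑ z ∈ hfin.toFinset, (w z * latticeLaplacianZd Ψ z - Ψ z * latticeLaplacianZd w z)
        = -w p := by
      calc _ = ∑ z ∈ hfin.toFinset, (if z = p then -w z else 0) := by
            refine Finset.sum_congr rfl fun z hz => ?_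
            have hzB := hfin.mem_toFinset.1 hz
            have h1 : latticeLaplacianZd Ψ z = V z * Ψ z + (if z = p then -1 else 0) := by
              linarith [hΨ z hzB]
            rw [h1, hw z hzB]
            split_ifs <;> ring
        _ = -w p := by simp only [Finset.sum_ite_eq', if_pos hpD]
    have hr : ∑ z ∈ hfin.toFinset, ∑ i : Fin 3, ((if z + Pi.single i 1 ∈ hfin.toFinset then (0 : ℝ)
          else (w z * Ψ (z + Pi.single i 1) - Ψ z * w (z + Pi.single i 1))) +
          (if z - Pi.single i 1 ∈ hfin.toFinset then (0 : ℝ)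
            else (w z * Ψ (z - Pi.single i 1) - Ψ z * w (z - Pi.single i 1)))) =
        -∑ z ∈ hfin.toFinset, Ψ z * F z := by
      rw [← Finset.sum_neg_distrib]
      refine Finset.sum_congr rfl fun z _ => ?_
      rw [hF, Finset.mul_sum, ← Finset.sum_neg_distrib]
      refine Finset.sum_congr rfl fun i _ => ?_
      split_ifs with h1 h2 h2
      · simp
      · rw [hΨ0' _ h2]; ring
      · rw [hΨ0' _ h1]; ring
      · rw [hΨ0' _ h1, hΨ0' _ h2]; ring
    linarith
  -- conclusion: `w x = Σ Ψx F ≤ 45 Σ Ψy F = 45 w y` termwise (`F ≥ 0`, `F = 0` off the annulus)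
  rw [hrep x Ψx hx hΨx hΨx0, hrep y Ψy hy hΨy hΨy0, Finset.mul_sum]
  refine Finset.sum_le_sum fun z hz => ?_
  have hzB : z ∈ B := hfin.mem_toFinset.1 hz
  have hF0 : 0 ≤ F z := by
    rw [hF]
    refine Finset.sum_nonneg fun i _ => add_nonneg ?_ ?_
    · split_ifs
      · exact le_rfl
      · exact hw0 _ (add_single_mem_union_zdOuterBoundary hzB i)
    · split_ifs
      · exact le_rfl
      · exact hw0 _ (sub_single_mem_union_zdOuterBoundary hzB i)
  by_cases hfar : R / 4 < nd z
  · rw [← mul_assoc]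
    exact mul_le_mul_of_nonneg_right (hA z hzB hfar) hF0
  · have hF' : F z = 0 := by
      rw [hF]
      refine Finset.sum_eq_zero fun i _ => ?_
      have h1 : z + Pi.single i 1 ∈ B := (hstep z i).1.trans (by linarith [not_lt.1 hfar])
      have h2 : z - Pi.single i 1 ∈ B := (hstep z i).2.trans (by linarith [not_lt.1 hfar])
      rw [if_pos (hfin.mem_toFinset.2 h1), if_pos (hfin.mem_toFinset.2 h2), add_zero]
    rw [hF', mul_zero, mul_zero, mul_zero]

end Summit.CriticalPhenomena.Ising3DConformalLimit.Theorems.PositiveSolutionAsymptotics
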